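/-
Copyright (c) 2026 the pub-hodgecm-mathlib formalisation cell (harness21).  Prover seat hodgecm-mathlib-K2Liu-p11 (g5), Track B «K2-LIT»,
#184♮ = hLiu418 = `stmt-HodgeConjecture-24832`; socket #41 `sig_K2LiuSiegelEisensteinContinuation`, KIND W, brick (3c) part 1: THE FACE CONVERSION for the `hBL`
assembler — the per-place (ii″) growth face of the twisted Whittaker continuations (★ `K2LiuKindWArchWhittakerGrowth`, Iwasawa letters `(R, T₂, det)`) converted to the
`hBL` alphabet (`‖det y‖`, entry-sum of `yᴴ·h·y`, `det (yᴴ h y)`) under the two-sided comparabilities of ★ `K2LiuKindWArchIwasawaComparability`.  KW desk F0P2-p08 (g4)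
2026-09-05T01:25:09Z (B); architect K2E3-p11 (g10).  THEOREMS ONLY (no `def`, no `instance`, no notation, no named-fact hypothesis, no `sorry`, default heartbeats).
-/
import Summits.HodgeConjecture.HodgeConjecture.Theorems.K2LiuKindWArchIwasawaComparability   -- ★ (3b) K2E3-p11: `iwasawa_comparability` (two-sided comparabilities of the two readings)
import Mathlib.Analysis.SpecialFunctions.Pow.Real
import Mathlib.Analysis.SpecialFunctions.Exp
import HarnessLib

/-!
# Crux `HLiu418`, socket #41, KIND W — brick (3c) part 1 `K2LiuKindWArchBlockGrowthConversion`: REAL-INEQUALITY CONVERSION OF THE (ii″) GROWTH FACE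
# `Cg·dR^e·e^{−cg T₂}·(1+T₂)^N·(1+D₂^{−N'})  ≤  Cg·K₀^E K₁^N K₂^{N'} · dCy^e·e^{−(cg∕K₁)Σ}·(1+Sy)^N·(1+D₁^{−N'})`

Cell `hodgecm-mathlib`, crux item hLiu418 = `stmt-HodgeConjecture-24832` (helper lane `--supports … --as helper`, count-neutral), route of record
`HCCMUnconditional`; squad K2 ∕ K2Liu, road `K2_Liu`, socket #41, KIND W.  The (3c) assembler `hBL_of_placeGrowth` (⊢ ★ p863724 :170–185) receives per complex place
the (ii″) face `‖Ew s‖ ≤ Cg·‖det R‖^{2−2re s}·e^{−cg·T₂}·(1+T₂)^N·(1+‖det(R h₁ R)‖^{−N'})` in the hermitian-`R` Iwasawa letters of the dispatch (★ `K2LiuKindWArchWhittakerGrowth`),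
and ★ `K2LiuKindWArchIwasawaComparability.iwasawa_comparability` (K2E3-p11) gives the TWO-SIDED comparabilities with the `hBL` reading `T·ã·T⁻¹ = (y b; 0 d)·κ`:
`‖det C‖‖det y‖ ≍_{K₀} ‖det R‖`, `Σ_{ab}‖(yᴴ h y)_{ab}‖ ≍_{K₁} T₂`, `‖det(yᴴ h y)‖ ≍_{K₂} ‖det(R h₁ R)‖`.  THIS FILE is the pure real-inequality step turning the one face into
the other with constants depending only on `(K₀, K₁, K₂, E, N, N')` — NO matrices, NO frames:
* `rpow_le_mul_rpow_of_two_sided` — `x ≍_K y`, `|e| ≤ E` ⇒ `x^e ≤ K^E·y^e` (the exponent `2 − 2re s` has BOTH signs on `s`-balls; two-sidedness is essential);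
* `exp_neg_mul_le_of_le_mul` — `Σ ≤ K·T` ⇒ `e^{−cg T} ≤ e^{−(cg∕K)Σ}`;   * `one_add_rpow_le_of_le_mul` — `T ≤ K·Σ` ⇒ `(1+T)^N ≤ K^N·(1+Sy)^N`;
* `one_add_rpow_neg_le_of_le_mul` — `D₁ ≤ K·D₂` ⇒ `1 + D₂^{−N'} ≤ K^{N'}·(1 + D₁^{−N'})` (the BLOW-UP factor of (KW-R5): allowed, converted, never absorbed);
* **`growthFace_le_of_comparable`** — the four together: ONE constant `Cg·K₀^E·K₁^N·K₂^{N'}`, decay rate `cg∕K₁`;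
* §3 **`placeFace_le_of_iwasawa`** — the conversion AT the Iwasawa data of one place, on ★ (3b) `iwasawa_comparability` (constants `2(16 M MG)²`, `4(16 M MG)²`, `4(16 M MG)⁴`);
* §4 `rpow_le_of_two_sided_height` — a two-sided height letter `P, P⁻¹ ≤ Ch·H^{ah}` moves `P^e` (`|e| ≤ E`) to `Ch^E·H^{ah·E}`.
[Shimura1982, §3 Thm. 3.1] [Shimura1997, §16.4, §18.4] [KudlaRallis1994, §1].
HONEST LABEL.  Count-neutral helper; closes no socket by itself: `HC_CM` is proved only modulo the 7 printed citations (2 remaining named inputs: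
hLiu418 = `stmt-HodgeConjecture-24832`, h413 = `stmt-HodgeConjecture-24833`) until rung 0 closes.

## References
* [Shimura1982] G. Shimura, *Confluent hypergeometric functions on tube domains*, Math. Ann. 260 (1982), §3 Thm. 3.1 (growth of the archimedean Whittaker function).
* [Shimura1997] G. Shimura, *Euler Products and Eisenstein Series*, CBMS 93 (1997), §16.4, §18.4.
* [KudlaRallis1994] S. Kudla, S. Rallis, Ann. of Math. 140 (1994), §1 (uniform estimates for the Fourier coefficients).
-/

set_option autoImplicit false
set_option linter.dupNamespace false -- the mandated namespace repeats `HodgeConjecture.HodgeConjecture`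

noncomputable section

open Real Complex Matrix
open scoped ComplexConjugate

namespace Summit.HodgeConjecture.HodgeConjecture.Cruxes.HLiu418.K2LiuKindWArchBlockGrowthConversion

open Literature.NumberTheory.ModularForms.SiegelUpperHalfSpace (moeb)
open Summit.HodgeConjecture.HodgeConjecture.Cruxes.HLiu418.K2LiuKindWArchIwasawaComparability (iwasawa_comparability)

/-! ## §1 Four real inequalities -/

/-- **two-sided comparability moves real powers of EITHER sign**: `0 < x, y`, `x ≤ K y`, `y ≤ K x`, `1 ≤ K`, `|e| ≤ E` ⇒ `x ^ e ≤ K ^ E * y ^ e`. [folklore] -/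
theorem rpow_le_mul_rpow_of_two_sided {x y K e E : ℝ} (hx : 0 < x) (hy : 0 < y) (hK : 1 ≤ K) (hxy : x ≤ K * y) (hyx : y ≤ K * x) (he : |e| ≤ E) :
    x ^ e ≤ K ^ E * y ^ e := by
  have hK0 : 0 < K := lt_of_lt_of_le one_pos hK
  rcases le_or_gt 0 e with he0 | he0
  · -- `e ≥ 0`: `x^e ≤ (K y)^e = K^e y^e ≤ K^E y^e`
    calc x ^ e ≤ (K * y) ^ e := Real.rpow_le_rpow hx.le hxy he0
      _ = K ^ e * y ^ e := Real.mul_rpow hK0.le hy.le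
      _ ≤ K ^ E * y ^ e := by
          refine mul_le_mul_of_nonneg_right (Real.rpow_le_rpow_of_exponent_le hK ?_) (Real.rpow_nonneg hy.le e)
          exact (le_abs_self e).trans he
  · -- `e < 0`: `x ≥ y / K` ⇒ `x^e ≤ (y/K)^e = y^e · K^{−e} ≤ K^E y^e`
    have hyK : y / K ≤ x := by rw [div_le_iff₀ hK0]; linarith [mul_comm K x]
    calc x ^ e ≤ (y / K) ^ e := Real.rpow_le_rpow_of_nonpos (div_pos hy hK0) hyK he0.le
      _ = y ^ e / K ^ e := Real.div_rpow hy.le hK0.le e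
      _ = K ^ (-e) * y ^ e := by rw [Real.rpow_neg hK0.le, div_eq_mul_inv, mul_comm]
      _ ≤ K ^ E * y ^ e := by
          refine mul_le_mul_of_nonneg_right (Real.rpow_le_rpow_of_exponent_le hK ?_) (Real.rpow_nonneg hy.le e)
          exact (neg_le_abs e).trans he

/-- `Σ ≤ K · T`, `0 ≤ cg`, `0 < K` ⇒ `exp(−cg·T) ≤ exp(−(cg∕K)·Sy)`. [folklore] -/
theorem exp_neg_mul_le_of_le_mul {cg T Sy K : ℝ} (hK : 0 < K) (hcg : 0 ≤ cg) (h : Sy ≤ K * T) :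
    Real.exp (-(cg * T)) ≤ Real.exp (-(cg / K * Sy)) := by
  rw [Real.exp_le_exp, neg_le_neg_iff, div_mul_eq_mul_div, div_le_iff₀ hK]
  calc cg * Sy ≤ cg * (K * T) := mul_le_mul_of_nonneg_left h hcg
    _ = cg * T * K := by ring

/-- `0 ≤ T ≤ K · Σ`, `1 ≤ K`, `0 ≤ N` ⇒ `(1 + T)^N ≤ K^N · (1 + Sy)^N`. [folklore] -/
theorem one_add_rpow_le_of_le_mul {T Sy K N : ℝ} (hK : 1 ≤ K) (hT : 0 ≤ T) (hSy : 0 ≤ Sy) (h : T ≤ K * Sy) (hN : 0 ≤ N) :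
    (1 + T) ^ N ≤ K ^ N * (1 + Sy) ^ N := by
  have hK0 : 0 ≤ K := le_trans zero_le_one hK
  calc (1 + T) ^ N ≤ (K * (1 + Sy)) ^ N := by
        refine Real.rpow_le_rpow (by linarith) ?_ hN
        nlinarith
    _ = K ^ N * (1 + Sy) ^ N := Real.mul_rpow hK0 (by linarith)

/-- **the blow-up factor converts**: `0 < D₁ ≤ K · D₂`, `1 ≤ K`, `0 ≤ N'` ⇒ `1 + D₂^{−N'} ≤ K^{N'} · (1 + D₁^{−N'})`. [folklore] -/
theorem one_add_rpow_neg_le_of_le_mul {D₁ D₂ K N' : ℝ} (hK : 1 ≤ K) (hD₁ : 0 < D₁) (h : D₁ ≤ K * D₂) (hN' : 0 ≤ N') :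
    1 + D₂ ^ (-N') ≤ K ^ N' * (1 + D₁ ^ (-N')) := by
  have hK0 : 0 < K := lt_of_lt_of_le one_pos hK
  have hD₂ : D₁ / K ≤ D₂ := by rw [div_le_iff₀ hK0]; linarith [mul_comm K D₂]
  have hD₂0 : 0 < D₂ := lt_of_lt_of_le (div_pos hD₁ hK0) hD₂
  have h1 : D₂ ^ (-N') ≤ (D₁ / K) ^ (-N') := Real.rpow_le_rpow_of_nonpos (div_pos hD₁ hK0) hD₂ (by linarith)
  have h2 : (D₁ / K) ^ (-N') = K ^ N' * D₁ ^ (-N') := by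
    rw [Real.div_rpow hD₁.le hK0.le, Real.rpow_neg hK0.le, div_inv_eq_mul, mul_comm]
  have h3 : (1 : ℝ) ≤ K ^ N' := Real.one_le_rpow hK hN'
  have h4 : 0 ≤ D₁ ^ (-N') := Real.rpow_nonneg hD₁.le _
  calc 1 + D₂ ^ (-N') ≤ K ^ N' + K ^ N' * D₁ ^ (-N') := add_le_add h3 (h1.trans_eq h2)
    _ = K ^ N' * (1 + D₁ ^ (-N')) := by ring

/-! ## §2 The face conversion -/

/-- **THE (ii″) FACE IN THE `hBL` ALPHABET.**  Data: the Iwasawa-letter face quantities `dR = ‖det R‖ > 0`, `T₂ ≥ 0` (entry-sum of `R h₁ R`), `D₂` (its `‖det‖`), and the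
`hBL`-reading quantities `dCy = ‖det C‖·‖det y‖ > 0`, `Σ ≥ 0` (entry-sum of `yᴴ h y`), `D₁ > 0` (its `‖det‖`), two-sided comparable with constants `K₀ K₁ K₂ ≥ 1` (★
`iwasawa_comparability`); an exponent `e` (`= 2 − 2re s`) with `|e| ≤ E`; face constants `Cg ≥ 0, cg ≥ 0, N ≥ 0, N' ≥ 0`.  THEN
`Cg·dR^e·e^{−cg T₂}·(1+T₂)^N·(1+D₂^{−N'}) ≤ (Cg·K₀^E·K₁^N·K₂^{N'})·dCy^e·e^{−(cg∕K₁)Σ}·(1+Sy)^N·(1+D₁^{−N'})` (§1, termwise). [cite: Shimura1982, §3 Thm. 3.1]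
[cite: KudlaRallis1994, §1] -/
theorem growthFace_le_of_comparable {Cg cg N N' K₀ K₁ K₂ E e dR dCy T₂ Sy D₁ D₂ : ℝ}
    (hCg : 0 ≤ Cg) (hcg : 0 ≤ cg) (hN : 0 ≤ N) (hN' : 0 ≤ N') (hK₀ : 1 ≤ K₀) (hK₁ : 1 ≤ K₁) (hK₂ : 1 ≤ K₂) (he : |e| ≤ E)
    (hdR : 0 < dR) (hdCy : 0 < dCy) (hRC : dR ≤ K₀ * dCy) (hCR : dCy ≤ K₀ * dR)
    (hT₂ : 0 ≤ T₂) (hSy : 0 ≤ Sy) (hSyT : Sy ≤ K₁ * T₂) (hTSy : T₂ ≤ K₁ * Sy)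
    (hD₁ : 0 < D₁) (hD : D₁ ≤ K₂ * D₂) :
    Cg * dR ^ e * Real.exp (-(cg * T₂)) * (1 + T₂) ^ N * (1 + D₂ ^ (-N')) ≤
      (Cg * K₀ ^ E * K₁ ^ N * K₂ ^ N') * dCy ^ e * Real.exp (-(cg / K₁ * Sy)) * (1 + Sy) ^ N * (1 + D₁ ^ (-N')) := by
  have h1 := rpow_le_mul_rpow_of_two_sided hdR hdCy hK₀ hRC hCR he
  have h2 := exp_neg_mul_le_of_le_mul (lt_of_lt_of_le one_pos hK₁) hcg hSyT
  have h3 := one_add_rpow_le_of_le_mul hK₁ hT₂ hSy hTSy hN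
  have h4 := one_add_rpow_neg_le_of_le_mul hK₂ hD₁ hD hN'
  -- every factor on the left is non-negative, every constant on the right is ≥ its counterpart
  have a1 : 0 ≤ dR ^ e := Real.rpow_nonneg hdR.le e
  have a2 : 0 ≤ Real.exp (-(cg * T₂)) := (Real.exp_pos _).le
  have a3 : 0 ≤ (1 + T₂) ^ N := Real.rpow_nonneg (by linarith) N
  have a4 : 0 ≤ 1 + D₂ ^ (-N') := by
    have : 0 ≤ D₂ ^ (-N') := Real.rpow_nonneg (le_of_lt (lt_of_lt_of_le (div_pos hD₁ (lt_of_lt_of_le one_pos hK₂))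
      (by rw [div_le_iff₀ (lt_of_lt_of_le one_pos hK₂)]; linarith [mul_comm K₂ D₂]))) _
    linarith
  have b1 : 0 ≤ K₀ ^ E * dCy ^ e := mul_nonneg (Real.rpow_nonneg (le_trans zero_le_one hK₀) E) (Real.rpow_nonneg hdCy.le e)
  have b2 : 0 ≤ Real.exp (-(cg / K₁ * Sy)) := (Real.exp_pos _).le
  have b3 : 0 ≤ K₁ ^ N * (1 + Sy) ^ N := mul_nonneg (Real.rpow_nonneg (le_trans zero_le_one hK₁) N) (Real.rpow_nonneg (by linarith) N)
  calc Cg * dR ^ e * Real.exp (-(cg * T₂)) * (1 + T₂) ^ N * (1 + D₂ ^ (-N'))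
      ≤ Cg * (K₀ ^ E * dCy ^ e) * Real.exp (-(cg / K₁ * Sy)) * (K₁ ^ N * (1 + Sy) ^ N) * (K₂ ^ N' * (1 + D₁ ^ (-N'))) := by
        gcongr
    _ = (Cg * K₀ ^ E * K₁ ^ N * K₂ ^ N') * dCy ^ e * Real.exp (-(cg / K₁ * Sy)) * (1 + Sy) ^ N * (1 + D₁ ^ (-N')) := by ring

/-! ## §3 The per-place conversion at the Iwasawa data (★ (3b) `iwasawa_comparability` + §2) -/

/-- `det (R · h₁ · R) ≠ 0` for `h₁ = C⁻ᴴ·h·C⁻¹`, `R`, `C` invertible, `det h ≠ 0`. [folklore] -/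
theorem det_levi_index_ne_zero {C hidx R : Matrix (Fin 2) (Fin 2) ℂ} (hC : IsUnit C.det) (hR : IsUnit R.det) (hh : hidx.det ≠ 0) :
    (R * ((C⁻¹)ᴴ * hidx * C⁻¹) * R).det ≠ 0 := by
  have hCi : (C⁻¹).det ≠ 0 := (Matrix.isUnit_nonsing_inv_det C hC).ne_zero
  have hCi' : ((C⁻¹)ᴴ).det ≠ 0 := by
    rw [Matrix.det_conjTranspose]
    exact (star_ne_zero).2 hCi
  simp only [Matrix.det_mul]
  exact mul_ne_zero (mul_ne_zero hR.ne_zero (mul_ne_zero (mul_ne_zero hCi' hh) hCi)) hR.ne_zero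

/-- **THE PER-PLACE CONVERSION.**  At one complex place: the `hBL` reading `T·ã·T⁻¹ = (y b; 0 d)·κ` (`‖κ‖,‖κ⁻¹‖ ≤ M`), the fixed right factor `G = Fr(g) ∈ U(J)` (`‖G‖ ≤ MG`), the
anti-diagonal base point, ANY hermitian-`R` Iwasawa decomposition `diag(C,−B)·((y b;0 d)·κ·G) = n(X₀)·m(R)·u₀` (★ (L4) `exists_transl_levi_mul_stabilizer`), a hermitian index
`h` with `det h ≠ 0` and `C` invertible; and a bound of the (ii″) shape on a quantity `Ev ≥ 0`.  THEN the same bound in the `hBL` alphabet with constants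
`K₀ = 2(16 M MG)²`, `K₁ = 4(16 M MG)²`, `K₂ = 4(16 M MG)⁴` (★ `iwasawa_comparability`) merged by §2. [cite: Shimura1982, §3 Thm. 3.1] [cite: Shimura1997, §16.4] -/
theorem placeFace_le_of_iwasawa {B C : Matrix (Fin 2) (Fin 2) ℂ}
    (hx : (fromBlocks 0 B C 0 : Matrix (Fin 2 ⊕ Fin 2) (Fin 2 ⊕ Fin 2) ℂ)ᴴ * Matrix.J (Fin 2) ℂ * (fromBlocks 0 B C 0 : Matrix (Fin 2 ⊕ Fin 2) (Fin 2 ⊕ Fin 2) ℂ) =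
      Matrix.J (Fin 2) ℂ) (hC : IsUnit C.det)
    {G : Matrix (Fin 2 ⊕ Fin 2) (Fin 2 ⊕ Fin 2) ℂ} (hG : Gᴴ * Matrix.J (Fin 2) ℂ * G = Matrix.J (Fin 2) ℂ) {MG : ℝ} (hMG : 1 ≤ MG) (hGb : ∀ i j, ‖G i j‖ ≤ MG)
    {κ κ' : Matrix (Fin 2 ⊕ Fin 2) (Fin 2 ⊕ Fin 2) ℂ} (hκκ' : κ * κ' = 1) {M : ℝ} (hM : 1 ≤ M) (hκb : ∀ i j, ‖κ i j‖ ≤ M) (hκ'b : ∀ i j, ‖κ' i j‖ ≤ M)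
    {y b d : Matrix (Fin 2) (Fin 2) ℂ} {X₀ R : Matrix (Fin 2) (Fin 2) ℂ} {u₀ : Matrix (Fin 2 ⊕ Fin 2) (Fin 2 ⊕ Fin 2) ℂ}
    (hR : Rᴴ = R) (hRu : IsUnit R.det) (hu₀ : u₀ᴴ * Matrix.J (Fin 2) ℂ * u₀ = Matrix.J (Fin 2) ℂ) (hu₀I : moeb u₀ (I • (1 : Matrix (Fin 2) (Fin 2) ℂ)) = I • 1)
    (hdec : (fromBlocks C 0 0 (-B) : Matrix (Fin 2 ⊕ Fin 2) (Fin 2 ⊕ Fin 2) ℂ) * ((fromBlocks y b 0 d : Matrix (Fin 2 ⊕ Fin 2) (Fin 2 ⊕ Fin 2) ℂ) * κ * G) =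
      fromBlocks 1 X₀ 0 1 * fromBlocks R 0 0 R⁻¹ * u₀)
    {hidx : Matrix (Fin 2) (Fin 2) ℂ} (hhidx : hidx.det ≠ 0)
    {Cg cg N N' E e Ev : ℝ} (hCg : 0 ≤ Cg) (hcg : 0 ≤ cg) (hN : 0 ≤ N) (hN' : 0 ≤ N') (he : |e| ≤ E)
    (hface : Ev ≤ Cg * ‖R.det‖ ^ e * Real.exp (-(cg * ∑ a, ∑ b, ‖(R * ((C⁻¹)ᴴ * hidx * C⁻¹) * R) a b‖)) *
      (1 + ∑ a, ∑ b, ‖(R * ((C⁻¹)ᴴ * hidx * C⁻¹) * R) a b‖) ^ N * (1 + ‖(R * ((C⁻¹)ᴴ * hidx * C⁻¹) * R).det‖ ^ (-N'))) :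
    Ev ≤ (Cg * (2 * (16 * M * MG) ^ 2) ^ E * (4 * (16 * M * MG) ^ 2) ^ N * (4 * (16 * M * MG) ^ 4) ^ N') *
      (‖C.det‖ * ‖y.det‖) ^ e * Real.exp (-(cg / (4 * (16 * M * MG) ^ 2) * ∑ a, ∑ b, ‖(yᴴ * hidx * y) a b‖)) *
      (1 + ∑ a, ∑ b, ‖(yᴴ * hidx * y) a b‖) ^ N * (1 + ‖(yᴴ * hidx * y).det‖ ^ (-N')) := by
  obtain ⟨h1, h2, h3, h4, h5, h6⟩ := iwasawa_comparability hx hG hGb hκκ' hκb hκ'b hR hRu hu₀ hu₀I hdec hidx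
  -- the constants are ≥ 1 (`16 M MG ≥ 16`)
  have hMM : (16 : ℝ) ≤ 16 * M * MG := by nlinarith
  have hK₀ : (1 : ℝ) ≤ 2 * (16 * M * MG) ^ 2 := by nlinarith
  have hK₁ : (1 : ℝ) ≤ 4 * (16 * M * MG) ^ 2 := by nlinarith
  have hK₂ : (1 : ℝ) ≤ 4 * (16 * M * MG) ^ 4 := by nlinarith [pow_le_pow_left₀ (by norm_num : (0:ℝ) ≤ 16) hMM 4]
  -- positivity of the two determinant readings
  have hdR : 0 < ‖R.det‖ := norm_pos_iff.2 hRu.ne_zero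
  have hdCy : 0 < ‖C.det‖ * ‖y.det‖ := lt_of_lt_of_le (div_pos hdR (lt_of_lt_of_le one_pos hK₀))
    (by rw [div_le_iff₀ (lt_of_lt_of_le one_pos hK₀)]; linarith [mul_comm (2 * (16 * M * MG) ^ 2) (‖C.det‖ * ‖y.det‖)])
  have hD₂ : 0 < ‖(R * ((C⁻¹)ᴴ * hidx * C⁻¹) * R).det‖ := norm_pos_iff.2 (det_levi_index_ne_zero hC hRu hhidx)
  have hD₁ : 0 < ‖(yᴴ * hidx * y).det‖ := lt_of_lt_of_le (div_pos hD₂ (lt_of_lt_of_le one_pos hK₂))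
    (by rw [div_le_iff₀ (lt_of_lt_of_le one_pos hK₂)]; linarith [mul_comm (4 * (16 * M * MG) ^ 4) ‖(yᴴ * hidx * y).det‖])
  have hT₂ : 0 ≤ ∑ a, ∑ b, ‖(R * ((C⁻¹)ᴴ * hidx * C⁻¹) * R) a b‖ := Finset.sum_nonneg fun _ _ => Finset.sum_nonneg fun _ _ => norm_nonneg _
  have hSy : 0 ≤ ∑ a, ∑ b, ‖(yᴴ * hidx * y) a b‖ := Finset.sum_nonneg fun _ _ => Finset.sum_nonneg fun _ _ => norm_nonneg _
  exact hface.trans (growthFace_le_of_comparable hCg hcg hN hN' hK₀ hK₁ hK₂ he hdR hdCy h2 h1 hT₂ hSy h3 h4 hD₁ h5)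

/-! ## §4 Height bookkeeping: a two-sided height letter moves real powers of either sign -/

/-- **a quantity two-sided bounded by a height power has all its real powers bounded by a height power**: `0 < P`, `P ≤ Ch·H^ah`, `P⁻¹ ≤ Ch·H^ah`, `1 ≤ Ch`, `1 ≤ H`, `0 ≤ ah`,
`|e| ≤ E` ⇒ `P^e ≤ Ch^E · H^(ah·E)` (used with `P = ∏_σ ‖det y_σ‖`, `e = 2 − 2re s`). [folklore] -/
theorem rpow_le_of_two_sided_height {P Ch ah H e E : ℝ} (hP : 0 < P) (hCh : 1 ≤ Ch) (hah : 0 ≤ ah) (hH : 1 ≤ H)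
    (h1 : P ≤ Ch * H ^ ah) (h2 : P⁻¹ ≤ Ch * H ^ ah) (he : |e| ≤ E) : P ^ e ≤ Ch ^ E * H ^ (ah * E) := by
  have hE : 0 ≤ E := (abs_nonneg e).trans he
  have hCh0 : 0 ≤ Ch := le_trans zero_le_one hCh
  have hH0 : 0 ≤ H := le_trans zero_le_one hH
  have hHah : 1 ≤ H ^ ah := Real.one_le_rpow hH hah
  have hB : 1 ≤ Ch * H ^ ah := by nlinarith
  -- `t ↦ (Ch·H^ah)^t` is monotone and dominates both `P^t` and `P^{−t}` for `t ≥ 0`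
  have key : ∀ t : ℝ, 0 ≤ t → t ≤ E → (Ch * H ^ ah) ^ t ≤ Ch ^ E * H ^ (ah * E) := fun t ht htE => by
    calc (Ch * H ^ ah) ^ t ≤ (Ch * H ^ ah) ^ E := Real.rpow_le_rpow_of_exponent_le hB htE
      _ = Ch ^ E * H ^ (ah * E) := by rw [Real.mul_rpow hCh0 (Real.rpow_nonneg hH0 ah), ← Real.rpow_mul hH0]
  rcases le_or_gt 0 e with he0 | he0
  · exact (Real.rpow_le_rpow hP.le h1 he0).trans (key e he0 ((le_abs_self e).trans he))
  · have hPe : P ^ e = P⁻¹ ^ (-e) := by rw [Real.inv_rpow hP.le, ← Real.rpow_neg hP.le, neg_neg]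
    rw [hPe]
    exact (Real.rpow_le_rpow (inv_pos.2 hP).le h2 (by linarith)).trans (key (-e) (by linarith) ((neg_le_abs e).trans he))

end Summit.HodgeConjecture.HodgeConjecture.Cruxes.HLiu418.K2LiuKindWArchBlockGrowthConversion

end
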